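import Literature.MathematicalPhysics.KineticTheory.SiteChainFokkerPlanckTruncation
import HarnessLib

/-!
# Fokker–Planck identification for site-inhomogeneous chains, IV: the `L¹` bound on the defect

Topic `Literature/MathematicalPhysics/KineticTheory`, grouping namespace `…KineticTheory.HeatConduction`.
For a uniformly confining site-dependent chain `P : SiteChain` (`N ≥ 1`, `T_L, T_R ≥ 0`) and a `C²`
integrable solution `ρ ≥ 0` of `L̂ρ + 2γρ = 0`, the stationary defect of the truncations
`f_{R,M} = χ(H/R) · M φ(ρ/M)` (`SiteChainFokkerPlanckTruncation.lean`) obeys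

  `∫ |L̂ f + 2γ f| ≤ K₀ ∫ θ_M(ρ) + K₃ ∫ 1_{R ≤ H} ρ + (K₄/√R) [ε W (m₀ + δ V) + m₀/ε]`

(`integral_abs_defect_le`; `θ_M(s) = s[M < s]`, `m₀ = ∫ρ`, `V = |{H ≤ 4R}|`, `W = 1 + arsinh²(2M/δ)`,
all `R ≥ 1`, `M, δ, ε > 0`): height terms via the entropy-type identity, cutoff term via
`|L̂ χ(H/R)| ≤ K 1_{R ≤ H}`, and the cross term `m'(ρ) Γ(χ(H/R), ρ)` (`integral_cross_le`) via
`|Dχ(H/R)·v_b| ≤ C/√R` on the shell, AM–GM and the weighted Fisher bound with the Fisher profile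
of `SiteChainFokkerPlanckProfiles.lean`. Twin of `Summits/…/EmbeddedDrudeMourreNessUniqueDefect.lean`
for site-dependent data.

## References

* N. Cuneo, J.-P. Eckmann, M. Hairer, L. Rey-Bellet, Electron. J. Probab. **23** (2018) no. 55, §3.1.
* D. Bakry, I. Gentil, M. Ledoux, *Analysis and Geometry of Markov Diffusion Operators* (2014), §5.
-/

noncomputable section

open MeasureTheory Filter Topology Set
open scoped ContDiff NNReal ENNReal

namespace Literature.MathematicalPhysics.KineticTheory.HeatConduction

open Literature.MathematicalPhysics.KineticTheory

variable {N : ℕ} {P : SiteChain}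

namespace SiteChain.UniformlyConfining

variable (hP : P.UniformlyConfining) (hN : 0 < N) {T_L T_R : ℝ} (hTL : 0 ≤ T_L) (hTR : 0 ≤ T_R)
  {ρ : PhaseSpace N → ℝ} (hρ : ContDiff ℝ 2 ρ) (hρ0 : ∀ x, 0 ≤ ρ x) (hρi : Integrable ρ)
  (hpde : ∀ x, sdeGenerator (fun y => -P.langevinDrift N y) (P.noiseVecL N T_L) (P.noiseVecR N T_R) ρ x +
    2 * P.γ * ρ x = 0)

include hP hN hρ hρ0 hρi hpde in
/-- **The cross term** (site-dependent chain). For `R ≥ 1`, `M, δ, ε > 0` (with the constants `K₁` of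
`|L χ(H/2R)| ≤ K₁` and `C` of `|Dχ(H/R)·bathVec| ≤ C|c|/√R`):
`∫ χ(ρ/M) |Γ(χ(H/R), ρ)| ≤ (C(c_L+c_R)/√R) [ε W (m₀ + δ |{H ≤ 4R}|) + (π/2)(K₁ + 2γ) m₀/ε]`,
`c_b = √(2γT_b)`, `m₀ = ∫ρ`, `W = 1 + arsinh²(2M/δ)`. [folklore] -/
theorem integral_cross_le {K₁ C : ℝ} (hK₁ : ∀ R : ℝ, 1 ≤ R → ∀ x,
      |sdeGenerator (P.langevinDrift N) (P.noiseVecL N T_L) (P.noiseVecR N T_R)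
        (fun y => smoothCutoff (P.hamiltonian N y / R)) x| ≤ K₁)
    (hC0 : 0 ≤ C) (hC : ∀ R : ℝ, 1 ≤ R → ∀ (x : PhaseSpace N) {k : ℕ} (hk : k < N) (c : ℝ),
      |fderiv ℝ (fun y => smoothCutoff (P.hamiltonian N y / R)) x (bathVec N k c)| ≤ C * |c| / Real.sqrt R ∧
      (¬ (R ≤ P.hamiltonian N x ∧ P.hamiltonian N x ≤ 2 * R) →
        fderiv ℝ (fun y => smoothCutoff (P.hamiltonian N y / R)) x (bathVec N k c) = 0))
    {R M δ ε : ℝ} (hR : 1 ≤ R) (hM : 0 < M) (hδ : 0 < δ) (hε : 0 < ε) :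
    ∫ x, smoothCutoff (ρ x / M) *
        |carreDuChamp (P.noiseVecL N T_L) (P.noiseVecR N T_R) (fun y => smoothCutoff (P.hamiltonian N y / R)) ρ x| ≤
      C * (|Real.sqrt (2 * P.γ * T_L)| + |Real.sqrt (2 * P.γ * T_R)|) / Real.sqrt R *
        (ε * (1 + Real.arsinh (2 * M / δ) ^ 2) *
            ((∫ x, ρ x) + δ * (volume {x | P.hamiltonian N x ≤ 4 * R}).toReal) +
          Real.pi / 2 * (K₁ + 2 * P.γ) * (∫ x, ρ x) / ε) := by
  have hU2 := hP.contDiff_U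
  have hV2 := hP.contDiff_V
  have hR0 : 0 < R := by linarith
  have h2R : 1 ≤ 2 * R := by linarith
  have h2R0 : 0 < 2 * R := by linarith
  obtain ⟨F, F', Fc, hF, hF', hFcc, hFb, hFc0, hFinv⟩ := exists_fisherProfile hδ (2 * M)
  set vL := P.noiseVecL N T_L with hvL
  set vR := P.noiseVecR N T_R with hvR
  set cL := Real.sqrt (2 * P.γ * T_L)
  set cR := Real.sqrt (2 * P.γ * T_R)
  set a : PhaseSpace N → ℝ := fun y => smoothCutoff (P.hamiltonian N y / R) with ha
  set ah : PhaseSpace N → ℝ := fun y => smoothCutoff (P.hamiltonian N y / (2 * R)) with hah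
  set W := 1 + Real.arsinh (2 * M / δ) ^ 2 with hW
  set Γρ := carreDuChamp vL vR ρ ρ with hΓρ
  set sh : Set (PhaseSpace N) := {x | R ≤ P.hamiltonian N x ∧ P.hamiltonian N x ≤ 2 * R} with hsh
  set Cc := C * (|cL| + |cR|) with hCc
  have hCc0 : 0 ≤ Cc := by positivity
  have hW1 : 1 ≤ W := by rw [hW]; nlinarith [sq_nonneg (Real.arsinh (2 * M / δ))]
  have hρc : Continuous ρ := hρ.continuous
  have hHc : Continuous (P.hamiltonian N) := (hP.contDiff_hamiltonian N).continuous
  have hsh_meas : MeasurableSet sh :=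
    (measurableSet_le measurable_const hHc.measurable).inter (measurableSet_le hHc.measurable measurable_const)
  have hsh_sub : sh ⊆ {x | P.hamiltonian N x ≤ 4 * R} := fun x hx => by
    simp only [Set.mem_setOf_eq] at hx ⊢; linarith [hx.2]
  have hV4 : volume {x | P.hamiltonian N x ≤ 4 * R} < (⊤ : ℝ≥0∞) :=
    (hP.isCompact_setOf_hamiltonian_le N (4 * R)).measure_lt_top
  have hVsh : volume sh < (⊤ : ℝ≥0∞) := (measure_mono hsh_sub).trans_lt hV4
  have hinv' : ∀ s, 0 ≤ s → s ≤ 2 * M → 1 / Fc s ≤ W * (s + δ) := fun s hs hs2 => by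
    rw [hW]; exact hFinv s hs hs2
  set Φ : PhaseSpace N → ℝ := fun x =>
    Cc / Real.sqrt R * (sh.indicator (fun x => ε * W * (ρ x + δ)) x + ah x * (Fc (ρ x) * Γρ x) / (2 * ε))
    with hΦ
  have hΓρ0 : ∀ x, 0 ≤ Γρ x := fun x => carreDuChamp_self_nonneg vL vR ρ x
  have hah_mem : ∀ x, ah x ∈ Icc (0:ℝ) 1 := fun x => P.energyCutoff_mem_Icc (2 * R) x
  have hpt : ∀ x, smoothCutoff (ρ x / M) * |carreDuChamp vL vR a ρ x| ≤ Φ x := by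
    intro x
    have hDa : ∀ (k : ℕ) (hk : k < N) (c : ℝ), |fderiv ℝ a x (bathVec N k c)| ≤ C * |c| / Real.sqrt R ∧
        (x ∉ sh → fderiv ℝ a x (bathVec N k c) = 0) := fun k hk c => hC R hR x hk c
    have hN1 : N - 1 < N := Nat.sub_lt hN one_pos
    have evL : vL = bathVec N 0 cL := rfl
    have evR : vR = bathVec N (N - 1) cR := rfl
    have hL := hDa 0 hN cL
    have hRt := hDa (N - 1) hN1 cR
    rw [← evL] at hL
    rw [← evR] at hRt
    rw [carreDuChamp_def]
    by_cases hx : x ∈ sh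
    · -- on the shell
      rw [hΦ]; dsimp only
      rw [Set.indicator_of_mem hx]
      have hWs : 0 ≤ W * (ρ x + δ) := by have := hρ0 x; positivity
      have hm := fun y : ℝ => smoothCutoff_div_mul_abs_le hM hFc0 hinv' hε (hρ0 x) hWs y
      have h1 : smoothCutoff (ρ x / M) * |fderiv ℝ a x vL * fderiv ℝ ρ x vL + fderiv ℝ a x vR * fderiv ℝ ρ x vR| ≤
          (Cc / Real.sqrt R) * (smoothCutoff (ρ x / M) * |fderiv ℝ ρ x vL| +
            smoothCutoff (ρ x / M) * |fderiv ℝ ρ x vR|) := by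
        have hm0 : 0 ≤ smoothCutoff (ρ x / M) := smoothCutoff_nonneg _
        have hbL : |fderiv ℝ a x vL| ≤ Cc / Real.sqrt R := by
          refine hL.1.trans ?_
          rw [hCc]; apply div_le_div_of_nonneg_right _ (Real.sqrt_nonneg _)
          nlinarith [abs_nonneg cL, abs_nonneg cR]
        have hbR : |fderiv ℝ a x vR| ≤ Cc / Real.sqrt R := by
          refine hRt.1.trans ?_
          rw [hCc]; apply div_le_div_of_nonneg_right _ (Real.sqrt_nonneg _)
          nlinarith [abs_nonneg cL, abs_nonneg cR]
        calc smoothCutoff (ρ x / M) * |fderiv ℝ a x vL * fderiv ℝ ρ x vL + fderiv ℝ a x vR * fderiv ℝ ρ x vR|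
            ≤ smoothCutoff (ρ x / M) * (|fderiv ℝ a x vL| * |fderiv ℝ ρ x vL| +
                |fderiv ℝ a x vR| * |fderiv ℝ ρ x vR|) := by
              refine mul_le_mul_of_nonneg_left ((abs_add_le _ _).trans ?_) hm0
              rw [abs_mul, abs_mul]
          _ ≤ smoothCutoff (ρ x / M) * ((Cc / Real.sqrt R) * |fderiv ℝ ρ x vL| +
                (Cc / Real.sqrt R) * |fderiv ℝ ρ x vR|) := by
              refine mul_le_mul_of_nonneg_left (add_le_add ?_ ?_) hm0
              · exact mul_le_mul_of_nonneg_right hbL (abs_nonneg _)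
              · exact mul_le_mul_of_nonneg_right hbR (abs_nonneg _)
          _ = _ := by ring
      refine h1.trans ?_
      have hCR : 0 ≤ Cc / Real.sqrt R := div_nonneg hCc0 (Real.sqrt_nonneg _)
      refine mul_le_mul_of_nonneg_left ?_ hCR
      have hA := hm (fderiv ℝ ρ x vL)
      have hB := hm (fderiv ℝ ρ x vR)
      have hah1 : ah x = 1 := P.energyCutoff_eq_one h2R0 hx.2
      rw [hah1, one_mul, hΓρ, carreDuChamp_self]
      have e : (ε * (W * (ρ x + δ)) + Fc (ρ x) * fderiv ℝ ρ x vL ^ 2 / ε) / 2 +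
          (ε * (W * (ρ x + δ)) + Fc (ρ x) * fderiv ℝ ρ x vR ^ 2 / ε) / 2 =
          ε * W * (ρ x + δ) + Fc (ρ x) * (fderiv ℝ ρ x vL ^ 2 + fderiv ℝ ρ x vR ^ 2) / (2 * ε) := by
        field_simp; ring
      linarith [hA, hB, e.le, e.ge]
    · -- off the shell both bath derivatives of the cutoff vanish
      rw [hL.2 hx, hRt.2 hx]
      simp only [zero_mul, add_zero, abs_zero, mul_zero]
      rw [hΦ]; dsimp only
      rw [Set.indicator_of_notMem hx, zero_add]
      have : 0 ≤ ah x * (Fc (ρ x) * Γρ x) / (2 * ε) :=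
        div_nonneg (mul_nonneg (hah_mem x).1 (mul_nonneg (hFc0 _).le (hΓρ0 x))) (by linarith)
      exact mul_nonneg (div_nonneg hCc0 (Real.sqrt_nonneg _)) this
  have ha2 : ContDiff ℝ 2 a := P.contDiff_energyCutoff hU2 hV2 N R
  have hah2 : ContDiff ℝ 2 ah := P.contDiff_energyCutoff hU2 hV2 N (2 * R)
  have hac : HasCompactSupport a := hP.hasCompactSupport_energyCutoff N hR0
  have hahc : HasCompactSupport ah := hP.hasCompactSupport_energyCutoff N h2R0
  have hi_lhs : Integrable fun x => smoothCutoff (ρ x / M) * |carreDuChamp vL vR a ρ x| :=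
    ((continuous_smoothCutoff.comp (hρc.div_const M)).mul
      (continuous_carreDuChamp_of_contDiff vL vR ha2 hρ).abs).integrable_of_hasCompactSupport
      (hasCompactSupport_carreDuChamp_left vL vR hac ρ).abs.mul_left
  have hi1 : Integrable (sh.indicator fun x => ε * W * (ρ x + δ)) := by
    refine IntegrableOn.integrable_indicator ?_ hsh_meas
    exact (hρi.integrableOn.add (integrableOn_const (C := δ) hVsh.ne)).const_mul (ε * W)
  have hi2 : Integrable fun x => ah x * (Fc (ρ x) * Γρ x) / (2 * ε) :=
    ((hah2.continuous.mul ((hFcc.comp hρc).mul (continuous_carreDuChamp_of_contDiff vL vR hρ hρ))).integrable_of_hasCompactSupport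
      hahc.mul_right).div_const _
  have hiΦ : Integrable Φ := (hi1.add hi2).const_mul _
  have b1 : ∫ x, sh.indicator (fun x => ε * W * (ρ x + δ)) x ≤
      ε * W * ((∫ x, ρ x) + δ * (volume {x | P.hamiltonian N x ≤ 4 * R}).toReal) := by
    rw [integral_indicator hsh_meas, integral_const_mul, integral_add hρi.integrableOn
      (integrableOn_const (C := δ) hVsh.ne), setIntegral_const, smul_eq_mul]
    have hεW : 0 ≤ ε * W := by positivity
    refine mul_le_mul_of_nonneg_left (add_le_add ?_ ?_) hεW
    · exact setIntegral_le_integral hρi (Eventually.of_forall hρ0)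
    · rw [mul_comm]
      refine mul_le_mul_of_nonneg_left ?_ hδ.le
      exact measureReal_mono hsh_sub hV4.ne
  have hfisher := P.half_integral_weightedFisher_le hU2 hV2 hN hP.γ_nonneg T_L T_R hρ hρ0 hpde hF hF' hFcc
    (θ := fun s => s) (ℓ := Real.pi / 2)
    (fun s hs => (hFb s hs).1) (fun s hs => (hFb s hs).2.1)
    (fun s hs => (hFb s hs).2.2.1) (fun s hs => (hFb s hs).2.2.2)
    hρi hah2 hahc (fun x => (hah_mem x).2) (hK₁ (2 * R) h2R)
  have b2 : ∫ x, ah x * (Fc (ρ x) * Γρ x) / (2 * ε) ≤ Real.pi / 2 * (K₁ + 2 * P.γ) * (∫ x, ρ x) / ε := by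
    rw [integral_div]
    have e : (∫ x, ah x * (Fc (ρ x) * Γρ x)) / (2 * ε) =
        ((1 / 2) * ∫ x, ah x * (Fc (ρ x) * Γρ x)) / ε := by
      field_simp
    rw [e]
    exact div_le_div_of_nonneg_right hfisher hε.le
  have eΦ : ∫ x, Φ x = Cc / Real.sqrt R *
      ((∫ x, sh.indicator (fun x => ε * W * (ρ x + δ)) x) + ∫ x, ah x * (Fc (ρ x) * Γρ x) / (2 * ε)) := by
    rw [hΦ, integral_const_mul, integral_add hi1 hi2]
  calc ∫ x, smoothCutoff (ρ x / M) * |carreDuChamp vL vR a ρ x|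
      ≤ ∫ x, Φ x := integral_mono hi_lhs hiΦ hpt
    _ ≤ Cc / Real.sqrt R * (ε * W * ((∫ x, ρ x) + δ * (volume {x | P.hamiltonian N x ≤ 4 * R}).toReal) +
          Real.pi / 2 * (K₁ + 2 * P.γ) * (∫ x, ρ x) / ε) := by
        rw [eΦ]
        exact mul_le_mul_of_nonneg_left (add_le_add b1 b2) (div_nonneg hCc0 (Real.sqrt_nonneg _))
    _ = _ := by rw [hCc, hW]

include hP hN hTL hTR hρ hρ0 hρi hpde in
/-- **The `L¹` bound on the stationary defect of the truncations** (site-dependent chain). There are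
`K₀, K₃, K₄ ≥ 0` such that for all `R ≥ 1` and `M, δ, ε > 0`, with `f = χ(H/R) · M φ(ρ/M)`,
`∫ |L̂ f + 2γ f| ≤ K₀ ∫ θ_M(ρ) + K₃ ∫ 1_{R ≤ H} ρ + (K₄/√R)(ε (1 + arsinh²(2M/δ)) (∫ρ + δ |{H ≤ 4R}|) + ∫ρ/ε)`.
[folklore] -/
theorem integral_abs_defect_le :
    ∃ K₀ K₃ K₄ : ℝ, 0 ≤ K₀ ∧ 0 ≤ K₃ ∧ 0 ≤ K₄ ∧ ∀ (R M δ ε : ℝ), 1 ≤ R → 0 < M → 0 < δ → 0 < ε →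
      ∫ x, |sdeGenerator (fun y => -P.langevinDrift N y) (P.noiseVecL N T_L) (P.noiseVecR N T_R)
            (fun y => smoothCutoff (P.hamiltonian N y / R) * (M * linCutoff (ρ y / M))) x +
          2 * P.γ * (smoothCutoff (P.hamiltonian N x / R) * (M * linCutoff (ρ x / M)))| ≤
        K₀ * (∫ x, (if M < ρ x then ρ x else 0)) +
        K₃ * (∫ x, {x | R ≤ P.hamiltonian N x}.indicator ρ x) +
        K₄ / Real.sqrt R * (ε * (1 + Real.arsinh (2 * M / δ) ^ 2) *
            ((∫ x, ρ x) + δ * (volume {x | P.hamiltonian N x ≤ 4 * R}).toReal) + (∫ x, ρ x) / ε) := by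
  have hU2 := hP.contDiff_U
  have hV2 := hP.contDiff_V
  have hγ := hP.γ_nonneg
  obtain ⟨K₁, hK₁0, hK₁⟩ := hP.abs_generator_energyCutoff_le hN hTL hTR
  obtain ⟨K₂, hK₂0, hK₂⟩ := hP.abs_revGenerator_energyCutoff_le hN hTL hTR
  obtain ⟨C, hC0, hC⟩ := hP.abs_fderiv_energyCutoff_bathVec_le (N := N)
  set cLR := |Real.sqrt (2 * P.γ * T_L)| + |Real.sqrt (2 * P.γ * T_R)| with hcLR
  refine ⟨K₁ + 4 * P.γ, K₂, C * cLR * (1 + Real.pi / 2 * (K₁ + 2 * P.γ)), by positivity, hK₂0,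
    by positivity, fun R M δ ε hR hM hδ hε => ?_⟩
  have hR0 : 0 < R := by linarith
  set vL := P.noiseVecL N T_L with hvL
  set vR := P.noiseVecR N T_R with hvR
  set Lr := sdeGenerator (fun y => -P.langevinDrift N y) vL vR with hLr
  set a : PhaseSpace N → ℝ := fun y => smoothCutoff (P.hamiltonian N y / R) with ha
  set f : PhaseSpace N → ℝ := fun y => a y * (M * linCutoff (ρ y / M)) with hf
  set m₀ := ∫ x, ρ x with hm₀
  set V := (volume {x | P.hamiltonian N x ≤ 4 * R}).toReal with hVdef
  set W := 1 + Real.arsinh (2 * M / δ) ^ 2 with hW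
  have hρc : Continuous ρ := hρ.continuous
  have hYc : Continuous fun y => -P.langevinDrift N y := (P.contDiff_one_langevinDrift hU2 hV2 N).continuous.neg
  have ha2 : ContDiff ℝ 2 a := P.contDiff_energyCutoff hU2 hV2 N R
  have hac : HasCompactSupport a := hP.hasCompactSupport_energyCutoff N hR0
  have hf2 : ContDiff ℝ 2 f := contDiff_truncation hU2 hV2 hρ M R
  have hfc : HasCompactSupport f := hP.hasCompactSupport_truncation M hR0
  set θ : PhaseSpace N → ℝ := fun x => if M < ρ x then ρ x else 0 with hθ
  have hθi : Integrable θ := by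
    have e : θ = {x | M < ρ x}.indicator ρ := by
      funext x; simp only [hθ, Set.indicator_apply, Set.mem_setOf_eq]
    rw [e]
    exact hρi.indicator (measurableSet_lt measurable_const hρc.measurable)
  set g2 : PhaseSpace N → ℝ := fun x => a x * (-(deriv smoothCutoff (ρ x / M) / M) *
    carreDuChamp vL vR ρ ρ x) with hg2
  have hg2i : Integrable g2 :=
    ((ha2.continuous.mul (((((contDiff_smoothCutoff (n := 1)).continuous_deriv le_rfl).comp
      (hρc.div_const M)).div_const M).neg.mul (continuous_carreDuChamp_of_contDiff vL vR hρ hρ)))).integrable_of_hasCompactSupport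
      hac.mul_right
  set g3 : PhaseSpace N → ℝ := fun x => ρ x * |Lr a x| with hg3
  have hg3i : Integrable g3 :=
    (hρc.mul (continuous_sdeGenerator _ _ hYc ha2).abs).integrable_of_hasCompactSupport
      (hasCompactSupport_sdeGenerator _ _ hac).abs.mul_left
  set g4 : PhaseSpace N → ℝ := fun x => smoothCutoff (ρ x / M) * |carreDuChamp vL vR a ρ x| with hg4
  have hg4i : Integrable g4 :=
    ((continuous_smoothCutoff.comp (hρc.div_const M)).mul
      (continuous_carreDuChamp_of_contDiff vL vR ha2 hρ).abs).integrable_of_hasCompactSupport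
      (hasCompactSupport_carreDuChamp_left vL vR hac ρ).abs.mul_left
  have hEi : Integrable fun x => |Lr f x + 2 * P.γ * f x| :=
    (((continuous_sdeGenerator _ _ hYc hf2).add (continuous_const.mul hf2.continuous)).abs).integrable_of_hasCompactSupport
      ((hasCompactSupport_sdeGenerator _ _ hfc).add (hfc.mul_left)).abs
  have hpt : ∀ x, |Lr f x + 2 * P.γ * f x| ≤ 2 * P.γ * θ x + (1 / 2) * g2 x + g3 x + g4 x := fun x =>
    abs_revGenerator_truncation_add_le hU2 hV2 hρ hpde hγ hρ0 hM R x
  have hi12 : Integrable (fun x => 2 * P.γ * θ x + 1 / 2 * g2 x) :=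
    (hθi.const_mul (2 * P.γ)).add (hg2i.const_mul (1 / 2))
  have hi123 : Integrable (fun x => 2 * P.γ * θ x + 1 / 2 * g2 x + g3 x) := hi12.add hg3i
  have hi1234 : Integrable (fun x => 2 * P.γ * θ x + 1 / 2 * g2 x + g3 x + g4 x) := hi123.add hg4i
  have hint : ∫ x, |Lr f x + 2 * P.γ * f x| ≤
      2 * P.γ * (∫ x, θ x) + (1 / 2) * (∫ x, g2 x) + (∫ x, g3 x) + ∫ x, g4 x := by
    have h := integral_mono hEi hi1234 hpt
    rw [integral_add hi123 hg4i, integral_add hi12 hg3i, integral_add (hθi.const_mul (2 * P.γ))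
      (hg2i.const_mul (1 / 2)), integral_const_mul, integral_const_mul] at h
    exact h
  have b2 : (1 / 2) * ∫ x, g2 x ≤ 1 * (K₁ + 2 * P.γ) * ∫ x, θ x :=
    half_integral_height_le hU2 hV2 hρ hpde hP hN hρ0 hρi hM hR0 (hK₁ R hR)
  have b3 : ∫ x, g3 x ≤ K₂ * ∫ x, {x | R ≤ P.hamiltonian N x}.indicator ρ x := by
    rw [← integral_const_mul]
    refine integral_mono hg3i ((hρi.indicator (measurableSet_le measurable_const
      (hP.contDiff_hamiltonian N).continuous.measurable)).const_mul K₂) fun x => ?_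
    exact mul_abs_revGenerator_cutoff_le hρ0 (hK₂ R hR) x
  have b4 : ∫ x, g4 x ≤ C * cLR / Real.sqrt R * (ε * W * (m₀ + δ * V) + Real.pi / 2 * (K₁ + 2 * P.γ) * m₀ / ε) :=
    hP.integral_cross_le hN hρ hρ0 hρi hpde hK₁ hC0 hC hR hM hδ hε
  have hm₀ : 0 ≤ m₀ := integral_nonneg hρ0
  have hV0 : 0 ≤ V := ENNReal.toReal_nonneg
  have hW0 : 0 ≤ W := by positivity
  have b4' : C * cLR / Real.sqrt R * (ε * W * (m₀ + δ * V) + Real.pi / 2 * (K₁ + 2 * P.γ) * m₀ / ε) ≤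
      C * cLR * (1 + Real.pi / 2 * (K₁ + 2 * P.γ)) / Real.sqrt R * (ε * W * (m₀ + δ * V) + m₀ / ε) := by
    have hsq : 0 ≤ Real.sqrt R := Real.sqrt_nonneg _
    have hCc : 0 ≤ C * cLR := by positivity
    have hq : 0 ≤ Real.pi / 2 * (K₁ + 2 * P.γ) := by positivity
    have h1 : ε * W * (m₀ + δ * V) + Real.pi / 2 * (K₁ + 2 * P.γ) * m₀ / ε ≤
        (1 + Real.pi / 2 * (K₁ + 2 * P.γ)) * (ε * W * (m₀ + δ * V) + m₀ / ε) := by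
      have t1 : 0 ≤ ε * W * (m₀ + δ * V) := by positivity
      have t2 : 0 ≤ m₀ / ε := by positivity
      have e : (1 + Real.pi / 2 * (K₁ + 2 * P.γ)) * (ε * W * (m₀ + δ * V) + m₀ / ε) =
          ε * W * (m₀ + δ * V) + Real.pi / 2 * (K₁ + 2 * P.γ) * m₀ / ε +
            (Real.pi / 2 * (K₁ + 2 * P.γ) * (ε * W * (m₀ + δ * V)) + m₀ / ε) := by ring
      rw [e]
      nlinarith [mul_nonneg hq t1]
    calc C * cLR / Real.sqrt R * (ε * W * (m₀ + δ * V) + Real.pi / 2 * (K₁ + 2 * P.γ) * m₀ / ε)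
        ≤ C * cLR / Real.sqrt R * ((1 + Real.pi / 2 * (K₁ + 2 * P.γ)) * (ε * W * (m₀ + δ * V) + m₀ / ε)) :=
          mul_le_mul_of_nonneg_left h1 (div_nonneg hCc hsq)
      _ = _ := by ring
  have e0 : 2 * P.γ * (∫ x, θ x) + 1 * (K₁ + 2 * P.γ) * (∫ x, θ x) = (K₁ + 4 * P.γ) * ∫ x, θ x := by ring
  rw [hW] at b4'
  linarith [hint, b2, b3, b4, b4', e0]

end SiteChain.UniformlyConfining

end Literature.MathematicalPhysics.KineticTheory.HeatConduction
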